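import Summits.Ventures.PercRepro.SixFourResidueFourBetaCounts

/-!
# `PlaneAddTwoFour` — Theorem 21.6 at `t = 4` for every plane size, part 2: the one-long-line bound (p1, gen 7 — §19.7 Step 4, §21.6)

Two lines of a plane share at most one point, so at most one line of the trace `τ` has more than `h = ⌊(p+1)/2⌋`
points (`longLines_card_le_one`), and `Σ_λ C(m_λ, 2) = C(p, 2)`.  Hence for the additive bound
`30·J₄ ≥ A30 p + Σ_λ B30 p m_λ` of `SixFourResidueFourBetaCounts.lean`: with a rational `ρ = a/b ≤ 0` such that
`ρ·C(m,2) ≤ B30 p m` for every short size `m` (`2m ≤ p + 1`),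

  `Σ_λ B30 p m_λ ≥ B30 p m₁ + ρ·(C(p,2) − C(m₁,2))`   (`m₁` the long line, or `m₁ = 0` if there is none; `sum_B30_ge`),

so `J₄ ≥ 0` follows from the integer certificate `BetaCert4N p a b` (`ρ = a/b`): the short-line inequalities, the
no-long-line case and every long size `h < m₁ < p` (`J_four_nonneg_of_plane_add_two_of_cert`) — p2's
`SixFourResidueThreeBetaLong` with `20 → 30` and `B20 2 → B30`.  The certificates `ρ_p = min(0, min_{3 ≤ m ≤ h}
B30 p m/(30·C(m,2)))` are decided for every `4 ≤ p ≤ 100` in `SixFourResidueFourBetaTableA/B.lean`, and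
`(−p·2^h, 1)` is proved for every `p ≥ 101` in `SixFourResidueFourBetaTail.lean`.
-/

namespace PercRepro.SixFour

/-- The integer one-long-line certificate at `t = 4`, plane size `p`, with `ρ = a/b`. -/
def BetaCert4N (p : ℕ) (a : ℤ) (b : ℕ) : Prop :=
  0 < b ∧ a ≤ 0 ∧ (∀ m < p + 1, m * 2 ≤ p + 1 → 30 * a * (m.choose 2 : ℤ) ≤ (b : ℤ) * B30 p m) ∧
    0 ≤ (b : ℤ) * A30 p + 30 * a * (p.choose 2 : ℤ) ∧
    (∀ m₁ < p, p + 1 < m₁ * 2 → 0 ≤ (b : ℤ) * (A30 p + B30 p m₁) + 30 * a * ((p.choose 2 : ℤ) - (m₁.choose 2 : ℤ)))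

/-- `BetaCert4N` is decidable. -/
instance (p : ℕ) (a : ℤ) (b : ℕ) : Decidable (BetaCert4N p a b) := by unfold BetaCert4N; infer_instance

/-- `smallTot 0 p c = 0`. -/
theorem smallTot_zero' (p c : ℕ) : smallTot 0 p c = 0 := by
  unfold smallTot
  refine Finset.sum_eq_zero (fun j hj => ?_)
  rw [Finset.mem_filter] at hj
  exact Nat.choose_eq_zero_of_lt (by omega)

/-- `B30 p 0 = 0`. -/
theorem B30_zero (p : ℕ) : B30 p 0 = 0 := by
  unfold B30
  rw [smallTot_zero']
  simp [delta, eps, collCount, S3]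

open Finset ThmH

variable {α : Type*} [DecidableEq α] {M : Matroid α} [M.Finite] {G : Finset α}

section Long

variable (hs : Simple M) {τ : Finset α} (hτ : τ ⊆ gr M)
include hs

/-- At most one line meets `τ` in more than `(p + 1)/2` points. -/
theorem longLines_card_le_one :
    ((lines M).filter (fun L : Finset α => τ.card + 1 < (L ∩ τ).card * 2)).card ≤ 1 := by
  rw [Finset.card_le_one]
  intro L hL L' hL'
  rw [Finset.mem_filter] at hL hL'
  by_contra hne
  have := card_trace_add_card_trace_le hs (τ := τ) hL.1 hL'.1 hne
  omega

include hτ in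
/-- **The one-long-line bound**: `Σ_λ B30 p m_λ ≥ B30 p m₁ + ρ(C(p,2) − C(m₁,2))` for the long line `m₁` (or `m₁ = 0`). -/
theorem sum_B30_ge (hr : M.eRk (τ : Set α) = 3) (a : ℤ) (b : ℕ)
    (hshort : ∀ m < τ.card + 1, m * 2 ≤ τ.card + 1 → 30 * a * (m.choose 2 : ℤ) ≤ (b : ℤ) * B30 τ.card m) :
    ∃ m₁, m₁ < τ.card ∧ (m₁ = 0 ∨ τ.card + 1 < m₁ * 2) ∧
      (b : ℤ) * B30 τ.card m₁ + 30 * a * ((τ.card.choose 2 : ℤ) - (m₁.choose 2 : ℤ)) ≤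
        (b : ℤ) * ∑ L ∈ lines M, B30 τ.card (L ∩ τ).card := by
  set Lg := (lines M).filter (fun L : Finset α => τ.card + 1 < (L ∩ τ).card * 2) with hLg
  have hpairs : ∑ L ∈ lines M, ((L ∩ τ).card.choose 2 : ℤ) = (τ.card.choose 2 : ℤ) := by
    exact_mod_cast sum_choose_two_trace hs hτ
  have hsplit : ∀ f : Finset α → ℤ, ∑ L ∈ lines M, f L = ∑ L ∈ Lg, f L +
      ∑ L ∈ (lines M).filter (fun L : Finset α => ¬ τ.card + 1 < (L ∩ τ).card * 2), f L := by
    intro f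
    rw [hLg, Finset.sum_filter_add_sum_filter_not]
  have hshortsum : ∑ L ∈ (lines M).filter (fun L : Finset α => ¬ τ.card + 1 < (L ∩ τ).card * 2),
      30 * a * ((L ∩ τ).card.choose 2 : ℤ) ≤
      ∑ L ∈ (lines M).filter (fun L : Finset α => ¬ τ.card + 1 < (L ∩ τ).card * 2),
        (b : ℤ) * B30 τ.card (L ∩ τ).card := by
    refine Finset.sum_le_sum (fun L hL => ?_)
    rw [Finset.mem_filter] at hL
    have hle := Finset.card_le_card (Finset.inter_subset_right (s₁ := L) (s₂ := τ))
    exact hshort _ (by omega) (by omega)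
  have hcard := longLines_card_le_one hs (τ := τ)
  rw [← hLg] at hcard
  rcases Nat.lt_or_ge Lg.card 1 with h0 | h1
  · -- no long line
    have hempty : Lg = ∅ := Finset.card_eq_zero.1 (by omega)
    have hp3 := three_le_card_of_eRk_eq_three hr
    refine ⟨0, by omega, Or.inl rfl, ?_⟩
    rw [B30_zero, mul_zero, zero_add, Nat.choose_zero_succ, Nat.cast_zero, sub_zero, Finset.mul_sum, hsplit, hempty,
      Finset.sum_empty, zero_add]
    have hp : 30 * a * (τ.card.choose 2 : ℤ) =
        ∑ L ∈ (lines M).filter (fun L : Finset α => ¬ τ.card + 1 < (L ∩ τ).card * 2),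
          30 * a * ((L ∩ τ).card.choose 2 : ℤ) := by
      rw [← Finset.mul_sum]
      congr 1
      rw [← hpairs, hsplit (fun L => ((L ∩ τ).card.choose 2 : ℤ)), hempty, Finset.sum_empty, zero_add]
    rw [hp]
    exact hshortsum
  · -- exactly one long line `L₁`
    have hone : Lg.card = 1 := by omega
    obtain ⟨L₁, hL₁⟩ := Finset.card_eq_one.1 hone
    have hL₁mem : L₁ ∈ Lg := by rw [hL₁]; exact Finset.mem_singleton_self L₁
    rw [hLg, Finset.mem_filter] at hL₁mem
    have hlt : (L₁ ∩ τ).card < τ.card := by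
      have hle : (L₁ ∩ τ).card ≤ τ.card := Finset.card_le_card Finset.inter_subset_right
      rcases Nat.lt_or_ge (L₁ ∩ τ).card τ.card with h | h
      · exact h
      · exfalso
        have heq : L₁ ∩ τ = τ := Finset.eq_of_subset_of_card_le Finset.inter_subset_right h
        have hsub : τ ⊆ L₁ := by rw [← heq]; exact Finset.inter_subset_left
        have h2 := M.eRk_mono (Finset.coe_subset.2 hsub)
        rw [hr, (mem_lines.1 hL₁mem.1).2.2] at h2
        have h32 : (3 : ℕ) ≤ 2 := by exact_mod_cast h2
        omega
    refine ⟨(L₁ ∩ τ).card, hlt, Or.inr hL₁mem.2, ?_⟩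
    rw [Finset.mul_sum, hsplit, hL₁, Finset.sum_singleton]
    have hp : 30 * a * ((τ.card.choose 2 : ℤ) - ((L₁ ∩ τ).card.choose 2 : ℤ)) =
        ∑ L ∈ (lines M).filter (fun L : Finset α => ¬ τ.card + 1 < (L ∩ τ).card * 2),
          30 * a * ((L ∩ τ).card.choose 2 : ℤ) := by
      rw [← Finset.mul_sum]
      congr 1
      have := hsplit (fun L => ((L ∩ τ).card.choose 2 : ℤ))
      rw [hpairs, hL₁, Finset.sum_singleton] at this
      linarith
    rw [hp]
    linarith [hshortsum]

end Long

/-! ## The certified theorem -/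

section Final

variable (hs : Simple M) (hG : G ⊆ gr M) (hr : M.eRk (G : Set α) = 4) {P₀ : Finset α} (hP₀ : P₀ ∈ planes M)
include hs hG hr hP₀

/-- **Theorem 21.6 at `t = 4` from a certificate**: `G ∖ P₀ = {a, a′}` (`(P₀ ∩ G).card + 2 = G.card`) and
`BetaCert4N p a b` for `p = (P₀ ∩ G).card` give `0 ≤ J₄(G)`, for every plane size. -/
theorem J_four_nonneg_of_plane_add_two_of_cert (hcard : (P₀ ∩ G).card + 2 = G.card) {a : ℤ} {b : ℕ}
    (hcert : BetaCert4N (P₀ ∩ G).card a b) : 0 ≤ J M G 4 := by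
  obtain ⟨x, x', ht⟩ := twoOff_of_card (M := M) hcard
  have hshares := J_four_ge_shares ht hG hr hP₀
  by_cases hr3 : M.eRk ((P₀ ∩ G : Finset α) : Set α) = 3
  · have hadd := J_four_ge_additive hs hG hr hP₀ ht hr3
    obtain ⟨hb, -, hshort, hnone, hlong⟩ := hcert
    have hτ : P₀ ∩ G ⊆ gr M := Finset.inter_subset_right.trans hG
    obtain ⟨m₁, hm₁, hcase, hge⟩ := sum_B30_ge hs hτ hr3 a b hshort
    have hnn : 0 ≤ (b : ℤ) * (A30 (P₀ ∩ G).card + ∑ L ∈ lines M, B30 (P₀ ∩ G).card (L ∩ (P₀ ∩ G)).card) := by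
      rcases hcase with h0 | hl
      · subst h0
        rw [B30_zero, mul_zero, zero_add, Nat.choose_zero_succ, Nat.cast_zero, sub_zero] at hge
        nlinarith [hnone, hge]
      · have := hlong m₁ hm₁ hl
        nlinarith [this, hge]
    have hq : (0 : ℚ) ≤ (b : ℚ) * (((A30 (P₀ ∩ G).card : ℤ) : ℚ) +
        ∑ L ∈ lines M, ((B30 (P₀ ∩ G).card (L ∩ (P₀ ∩ G)).card : ℤ) : ℚ)) := by
      have := (Int.cast_le (R := ℚ)).2 hnn
      push_cast at this ⊢
      linarith
    have hbq : (0 : ℚ) < (b : ℚ) := by exact_mod_cast hb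
    have hJ : (0 : ℚ) ≤ (b : ℚ) * (30 * J M G 4) := le_trans hq (mul_le_mul_of_nonneg_left hadd hbq.le)
    nlinarith [hJ, hbq]
  · -- `τ` has rank `≤ 2`: `R₃(τ) = ∅`, and the regrouped sum reads `0 ≤ J₄`
    have hempty : R3 M (P₀ ∩ G) = ∅ := by
      rw [Finset.eq_empty_iff_forall_notMem]
      intro S hS
      obtain ⟨hSτ, hS3⟩ := mem_R3.1 hS
      apply hr3
      refine le_antisymm ?_ (by rw [← hS3]; exact M.eRk_mono (Finset.coe_subset.2 hSτ))
      rw [← (mem_planes.1 hP₀).2.2]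
      exact M.eRk_mono (Finset.coe_subset.2 Finset.inter_subset_left)
    rw [hempty, Finset.sum_empty, Finset.sum_empty] at hshares
    linarith

end Final

end PercRepro.SixFour
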